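import Mathlib
import Summits.CriticalPhenomena.PercolationContinuityZ3.Theorems.PercNearOneGluingNoHeavyLowerTailPairedSunflowerConjecture
import HarnessLib
import HarnessLib.Audit

/-!
# Conjecture MS♯ ("generated donors suffice") and the reduction MS♯ ⟹ K♯ (hp-7 g64, Lemma A in full generality)

Support file for crux `stmt-CriticalPhenomena-4575` (`NoHeavyLowerTail`), hull-port seat `prim-hp-7` (generation 64); `--supports stmt-CriticalPhenomena-4575`.
No `sorry`.  Memo `run/shared/lean/prim/prim-hp-7/FROM-prim-hp-7-g64-HEXMS.md` §0(1)–(2), §1.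

**Setting** (`OrientedAntipodalHall.KSharp`): monotone labellings `g h : Finset α → Lab 3`.  The hexagon class of a set `q` is recorded by its
SUPPORT, the set of arcs `(a,b)` (`a ≠ b`) of `K₃` with `g q ≥ C_a` and `h qᶜ ≤ C_b` (`InSupp`); supports of actual sets are `∅`, a single arc,
a 'tail star' `{ab, ac}`, a 'head star' `{ab, cb}` or everything (= `q` GOOD: `g q = A`, `h qᶜ = B`) — `supp_cases`.  A charged set has a
nonempty support; a DEBTOR set is a charged set `q` with neither `q` nor `qᶜ` good.
* `Linked g h q s` — 'c(q) ∨ c(s) = ⊤ and c(qᶜ) ∧ c(sᶜ) = ⊥' in support language: the union of the supports of `q` and `s` lies in no tail star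
  and no head star, and the supports of `qᶜ`, `sᶜ` are disjoint.  **Lemma A** (`good_compl_and_null_of_close`): if `Linked (qᶜ) s` ('`q` close to
  `s`') then `d = q \ s` is an ANTI-DONOR: `g dᶜ = A`, `h d = B`, and `d` has empty support (so is uncharged).
* `MSSharp` — **Conjecture MS♯**: for all monotone `g, h`, `#debtor sets ≤ 2 · #{q \ s : q, s debtor sets, Linked qᶜ s}`.  Exhaustively verified
  over all 30,046,920 monotone maps `2^[4] → 𝓗` and EXACTLY by SAT over all monotone maps on `2^[5]` (kissat UNSAT 47 s, kit j189937; n = 6 running);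
  for one antipodal axis it is the Marica–Schönheim inequality, its pure (vertex-labelled) core is `GeneratedDonors.ConjectureHexMS`.
* `kSharp_of_msSharp` — **MS♯ ⟹ K♯** (`OrientedAntipodalHall.KSharp 3`, hence Conjecture K and FS′/FS of g59): generated differences are anti-donors
  (Lemma A), anti-donors and donors are disjoint, uncharged, credited and equinumerous.
`@[conjecture] ConjectureMSSharp := MSSharp` is an OBLIGATION of this programme, never used as a fact.
-/

namespace Summit.CriticalPhenomena.PercolationContinuityZ3.Theorems

namespace GeneratedDonors

open Finset OrientedAntipodalHall AntipodalStrongHarris AntipodalStrongHarris.Lab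

/-- The arc `(a,b)` lies in the support of the hexagon class with labels `x = g q`, `y = h qᶜ`: `a ≠ b`, `x ≥ C_a`, `y ≤ C_b`. -/
def InSupp (x y : Lab 3) (a b : Fin 3) : Prop := a ≠ b ∧ (x = petal a ∨ x = top) ∧ (y = bot ∨ y = petal b)

/-- Support membership is decidable. -/
instance (x y : Lab 3) (a b : Fin 3) : Decidable (InSupp x y a b) := by unfold InSupp; infer_instance

/-- **Realizable supports.**  For any labels `(x, y)`: either `(x, y) = (A, B)` (full support), or all arcs of the support share their tail,
or all share their head (this covers the empty support, single arcs and the two kinds of stars = the proper hexagon elements). -/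
theorem supp_cases (x y : Lab 3) :
    (x = top ∧ y = bot) ∨ (∃ a : Fin 3, ∀ a' b' : Fin 3, InSupp x y a' b' → a' = a) ∨
      (∃ b : Fin 3, ∀ a' b' : Fin 3, InSupp x y a' b' → b' = b) := by
  unfold InSupp
  rcases x with _ | i | _ <;> rcases y with _ | j | _
  · exact Or.inr (Or.inl ⟨0, fun a' b' h => by rcases h.2.1 with h1 | h1 <;> cases h1⟩)
  · exact Or.inr (Or.inl ⟨0, fun a' b' h => by rcases h.2.1 with h1 | h1 <;> cases h1⟩)
  · exact Or.inr (Or.inl ⟨0, fun a' b' h => by rcases h.2.1 with h1 | h1 <;> cases h1⟩)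
  · exact Or.inr (Or.inl ⟨i, fun a' b' h => by
      rcases h.2.1 with h1 | h1
      · exact (petal.inj h1).symm
      · cases h1⟩)
  · exact Or.inr (Or.inl ⟨i, fun a' b' h => by
      rcases h.2.1 with h1 | h1
      · exact (petal.inj h1).symm
      · cases h1⟩)
  · exact Or.inr (Or.inl ⟨i, fun a' b' h => by
      rcases h.2.1 with h1 | h1
      · exact (petal.inj h1).symm
      · cases h1⟩)
  · exact Or.inl ⟨rfl, rfl⟩
  · exact Or.inr (Or.inr ⟨j, fun a' b' h => by
      rcases h.2.2 with h1 | h1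
      · cases h1
      · exact (petal.inj h1).symm⟩)
  · exact Or.inr (Or.inr ⟨0, fun a' b' h => by rcases h.2.2 with h1 | h1 <;> cases h1⟩)

section Defs

variable {α : Type*} [Fintype α] [DecidableEq α]

/-- `q` and `s` are LINKED: the union of their supports lies in no tail star and no head star ('c q ∨ c s = ⊤'), and the supports of their
complements are disjoint ('c qᶜ ∧ c sᶜ = ⊥'). -/
def Linked (g h : Finset α → Lab 3) (q s : Finset α) : Prop :=
  (¬ ∃ a : Fin 3, ∀ a' b' : Fin 3, (InSupp (g q) (h (univ \ q)) a' b' ∨ InSupp (g s) (h (univ \ s)) a' b') → a' = a) ∧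
  (¬ ∃ b : Fin 3, ∀ a' b' : Fin 3, (InSupp (g q) (h (univ \ q)) a' b' ∨ InSupp (g s) (h (univ \ s)) a' b') → b' = b) ∧
  (∀ a b : Fin 3, ¬ (InSupp (g (univ \ q)) (h q) a b ∧ InSupp (g (univ \ s)) (h s) a b))

/-- Linkedness is decidable. -/
instance (g h : Finset α → Lab 3) (q s : Finset α) : Decidable (Linked g h q s) := by unfold Linked; infer_instance

/-- `q` is CREDITED: `q` or `qᶜ` is good. -/
def Credited (g h : Finset α → Lab 3) (q : Finset α) : Prop :=
  (g q = top ∧ h (univ \ q) = bot) ∨ (g (univ \ q) = top ∧ h q = bot)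

/-- Creditedness is decidable. -/
instance (g h : Finset α → Lab 3) (q : Finset α) : Decidable (Credited g h q) := by unfold Credited; infer_instance

/-- The debtor sets: charged and not credited. -/
def debtors (g h : Finset α → Lab 3) : Finset (Finset α) :=
  {q ∈ (univ : Finset (Finset α)) | IsCharged 3 g h q ∧ ¬ Credited g h q}

/-- The generated family: differences `q \ s` of debtor sets with `q` close to `s`, i.e. `qᶜ` linked to `s`. -/
def genSharp (g h : Finset α → Lab 3) : Finset (Finset α) :=
  ((debtors g h ×ˢ debtors g h).filter fun p => Linked g h (univ \ p.1) p.2).image fun p => p.1 \ p.2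

end Defs

/-- **Conjecture MS♯** (hp-7 g64): for monotone `g, h : Finset α → Lab 3` the debtor sets number at most twice the generated differences.
An obligation, not a fact. -/
def MSSharp : Prop :=
  ∀ (α : Type) [Fintype α] [DecidableEq α] (g h : Finset α → Lab 3),
    (∀ ⦃X Y : Finset α⦄, X ⊆ Y → g X ≤ g Y) → (∀ ⦃X Y : Finset α⦄, X ⊆ Y → h X ≤ h Y) →
      #(debtors g h) ≤ 2 * #(genSharp g h)

/-- **CONJECTURE MS♯** as a typed obligation (exhaustive m = 4, exact SAT m = 5; memo FROM-prim-hp-7-g64-HEXMS.md). [this work; obligation] -/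
@[conjecture] def ConjectureMSSharp : Prop := MSSharp

section LemmaA

variable {α : Type*} [Fintype α] [DecidableEq α]

/-- Supports are monotone in the set: `q ⊆ q'` and `(a,b) ∈ supp q` give `(a,b) ∈ supp q'`. -/
theorem inSupp_mono {g h : Finset α → Lab 3}
    (hg : ∀ ⦃X Y : Finset α⦄, X ⊆ Y → g X ≤ g Y) (hh : ∀ ⦃X Y : Finset α⦄, X ⊆ Y → h X ≤ h Y)
    {q q' : Finset α} (hqq : q ⊆ q') {a b : Fin 3} (hab : InSupp (g q) (h (univ \ q)) a b) :
    InSupp (g q') (h (univ \ q')) a b := by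
  obtain ⟨hne, h1, h2⟩ := hab
  have hgq : g q ≤ g q' := hg hqq
  have hhq : h (univ \ q') ≤ h (univ \ q) := hh (sdiff_subset_sdiff (subset_refl _) hqq)
  rw [le_def] at hgq hhq
  refine ⟨hne, ?_, ?_⟩
  · rcases h1 with h1 | h1
    · rcases hgq with h3 | h3 | h3
      · rw [h3] at h1; cases h1
      · exact Or.inr h3
      · exact Or.inl (h3 ▸ h1)
    · rcases hgq with h3 | h3 | h3
      · rw [h3] at h1; cases h1
      · exact Or.inr h3
      · exact Or.inr (h3 ▸ h1)
  · rcases h2 with h2 | h2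
    · rcases hhq with h3 | h3 | h3
      · exact Or.inl h3
      · rw [h3] at h2; cases h2
      · exact Or.inl (h3.trans h2)
    · rcases hhq with h3 | h3 | h3
      · exact Or.inl h3
      · rw [h3] at h2; cases h2
      · exact Or.inr (h3.trans h2)

/-- A set with empty support is not charged. -/
theorem not_isCharged_of_supp_empty {g h : Finset α → Lab 3} {d : Finset α}
    (he : ∀ a b : Fin 3, ¬ InSupp (g d) (h (univ \ d)) a b) : ¬ IsCharged 3 g h d := by
  rintro ⟨a, b, hab, h1, -, -, h4⟩
  exact he a b ⟨hab, h1, h4⟩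

/-- **Lemma A** (hp-7 g64).  If `qᶜ` is linked to `s` then `d = q \ s` is an anti-donor: its complement is good and its own support is empty. -/
theorem good_compl_and_null_of_close {g h : Finset α → Lab 3}
    (hg : ∀ ⦃X Y : Finset α⦄, X ⊆ Y → g X ≤ g Y) (hh : ∀ ⦃X Y : Finset α⦄, X ⊆ Y → h X ≤ h Y)
    {q s : Finset α} (hl : Linked g h (univ \ q) s) :
    g (univ \ (q \ s)) = top ∧ h (q \ s) = bot ∧ ∀ a b : Fin 3, ¬ InSupp (g (q \ s)) (h (univ \ (q \ s))) a b := by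
  have hcc : ∀ x : Finset α, univ \ (univ \ x) = x := fun x => by
    rw [Finset.sdiff_sdiff_eq_self (subset_univ x)]
  obtain ⟨hl1, hl2, hl3⟩ := hl
  rw [hcc] at hl1 hl2 hl3
  -- inclusions
  have hsub1 : univ \ q ⊆ univ \ (q \ s) := sdiff_subset_sdiff (subset_refl _) sdiff_subset
  have hsub2 : s ⊆ univ \ (q \ s) := by
    intro x hx; rw [mem_sdiff]; exact ⟨mem_univ _, fun h' => (mem_sdiff.mp h').2 hx⟩
  have hsub3 : q \ s ⊆ q := sdiff_subset
  have hsub4 : q \ s ⊆ univ \ s := sdiff_subset_sdiff (subset_univ _) (subset_refl _)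
  -- the support of dᶜ contains both supports
  have hU : ∀ a' b' : Fin 3, (InSupp (g (univ \ q)) (h q) a' b' ∨ InSupp (g s) (h (univ \ s)) a' b') →
      InSupp (g (univ \ (q \ s))) (h (univ \ (univ \ (q \ s)))) a' b' := by
    intro a' b' hab
    rcases hab with hab | hab
    · have := inSupp_mono hg hh hsub1 (by rw [hcc]; exact hab)
      exact this
    · exact inSupp_mono hg hh hsub2 hab
  have hgood : g (univ \ (q \ s)) = top ∧ h (univ \ (univ \ (q \ s))) = bot := by
    rcases supp_cases (g (univ \ (q \ s))) (h (univ \ (univ \ (q \ s)))) with hc | ⟨a, ha⟩ | ⟨b, hb⟩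
    · exact hc
    · exact absurd ⟨a, fun a' b' hab => ha a' b' (hU a' b' hab)⟩ hl1
    · exact absurd ⟨b, fun a' b' hab => hb a' b' (hU a' b' hab)⟩ hl2
  rw [hcc] at hgood
  refine ⟨hgood.1, hgood.2, fun a b hab => hl3 a b ⟨?_, ?_⟩⟩
  · exact inSupp_mono hg hh hsub3 hab
  · have := inSupp_mono hg hh hsub4 hab
    rwa [hcc] at this

end LemmaA

section Reduction

variable {α : Type} [Fintype α] [DecidableEq α]

/-- Membership in the generated family. -/
theorem mem_genSharp {g h : Finset α → Lab 3} {d : Finset α} :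
    d ∈ genSharp g h ↔ ∃ q ∈ debtors g h, ∃ s ∈ debtors g h, Linked g h (univ \ q) s ∧ q \ s = d := by
  unfold genSharp
  constructor
  · intro hd
    obtain ⟨p, hp, rfl⟩ := mem_image.mp hd
    rw [mem_filter, mem_product] at hp
    exact ⟨p.1, hp.1.1, p.2, hp.1.2, hp.2, rfl⟩
  · rintro ⟨q, hq, s, hs, hl, rfl⟩
    exact mem_image.mpr ⟨(q, s), by rw [mem_filter, mem_product]; exact ⟨⟨hq, hs⟩, hl⟩, rfl⟩

/-- **MS♯ ⟹ K♯ inequality** for one instance: the generated differences are anti-donors (Lemma A); anti-donors and their complements are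
disjoint, credited, uncharged and equinumerous; debtors ≤ 2·generated. -/
theorem kSharp_ineq_of_msSharp_ineq (g h : Finset α → Lab 3)
    (hg : ∀ ⦃X Y : Finset α⦄, X ⊆ Y → g X ≤ g Y) (hh : ∀ ⦃X Y : Finset α⦄, X ⊆ Y → h X ≤ h Y)
    (hMS : #(debtors g h) ≤ 2 * #(genSharp g h)) :
    #{q ∈ (univ : Finset (Finset α)) | IsCharged 3 g h q} ≤
      #{q ∈ (univ : Finset (Finset α)) | (g q = top ∧ h (univ \ q) = bot) ∨ (g (univ \ q) = top ∧ h q = bot)} := by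
  classical
  have hcc : ∀ q : Finset α, univ \ (univ \ q) = q := fun q => by
    rw [Finset.sdiff_sdiff_eq_self (subset_univ q)]
  set Ch : Finset (Finset α) := {q ∈ (univ : Finset (Finset α)) | IsCharged 3 g h q} with hCh
  set Cr : Finset (Finset α) := {q ∈ (univ : Finset (Finset α)) |
    (g q = top ∧ h (univ \ q) = bot) ∨ (g (univ \ q) = top ∧ h q = bot)} with hCr
  set AD : Finset (Finset α) := {d ∈ (univ : Finset (Finset α)) |
    g (univ \ d) = top ∧ h d = bot ∧ ∀ a b : Fin 3, ¬ InSupp (g d) (h (univ \ d)) a b} with hAD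
  have hmemCr : ∀ q, q ∈ Cr ↔ Credited g h q := fun q => by
    rw [hCr, mem_filter]; unfold Credited; simp only [mem_univ, true_and]
  have hmemDeb : ∀ q, q ∈ debtors g h ↔ IsCharged 3 g h q ∧ ¬ Credited g h q := fun q => by
    unfold debtors; rw [mem_filter]; simp only [mem_univ, true_and]
  have hmemAD : ∀ d, d ∈ AD ↔ g (univ \ d) = top ∧ h d = bot ∧ ∀ a b : Fin 3, ¬ InSupp (g d) (h (univ \ d)) a b :=
    fun d => by rw [hAD, mem_filter]; simp only [mem_univ, true_and]
  have hmemCh : ∀ q, q ∈ Ch ↔ IsCharged 3 g h q := fun q => by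
    rw [hCh, mem_filter]; simp only [mem_univ, true_and]
  have hchsymm : ∀ q, IsCharged 3 g h q → IsCharged 3 g h (univ \ q) := by
    rintro q ⟨a, b, hab, h1, h2, h3, h4⟩
    exact ⟨b, a, hab.symm, h3, h4, by rw [hcc]; exact h1, by rw [hcc]; exact h2⟩
  have hcrsymm : ∀ q, Credited g h q → Credited g h (univ \ q) := by
    rintro q (⟨h1, h2⟩ | ⟨h1, h2⟩)
    · exact Or.inr ⟨by rw [hcc]; exact h1, h2⟩
    · exact Or.inl ⟨h1, by rw [hcc]; exact h2⟩
  -- generated ⊆ anti-donors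
  have hgenAD : genSharp g h ⊆ AD := by
    intro d hd
    obtain ⟨q, -, s, -, hl, rfl⟩ := mem_genSharp.mp hd
    exact (hmemAD _).2 (good_compl_and_null_of_close hg hh hl)
  have hADcr : ∀ d ∈ AD, Credited g h d := fun d hd => by
    obtain ⟨h1, h2, -⟩ := (hmemAD d).1 hd
    exact Or.inr ⟨h1, h2⟩
  have hADnch : ∀ d ∈ AD, ¬ IsCharged 3 g h d := fun d hd =>
    not_isCharged_of_supp_empty ((hmemAD d).1 hd).2.2
  set coAD : Finset (Finset α) := AD.image fun d => univ \ d with hcoAD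
  have hinj : ∀ q r : Finset α, univ \ q = univ \ r → q = r := fun q r hqr => by
    have := congrArg (fun s => (univ : Finset α) \ s) hqr
    simpa only [hcc] using this
  have hcoADcard : #coAD = #AD := card_image_of_injOn fun q _ r _ hqr => hinj q r hqr
  have hdisj : Disjoint AD coAD := by
    rw [disjoint_left]
    intro d hd hd'
    obtain ⟨d', hd'mem, hdd⟩ := mem_image.mp hd'
    obtain ⟨-, -, h3⟩ := (hmemAD _).1 hd
    obtain ⟨h1', h2', -⟩ := (hmemAD _).1 hd'mem
    -- d = univ \ d' : then g d = top and h (univ \ d) = h d' = bot, so (0,1) lies in the support of d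
    apply h3 0 1
    refine ⟨by decide, Or.inr ?_, Or.inl ?_⟩
    · rw [← hdd]; exact h1'
    · rw [← hdd, hcc]; exact h2'
  have hsub : AD ∪ coAD ⊆ Cr \ Ch := by
    intro d hd
    rw [mem_sdiff, hmemCr, hmemCh]
    rcases mem_union.mp hd with hd | hd
    · exact ⟨hADcr d hd, hADnch d hd⟩
    · obtain ⟨d', hd', rfl⟩ := mem_image.mp hd
      refine ⟨hcrsymm _ (hADcr d' hd'), fun hc => hADnch d' hd' ?_⟩
      have := hchsymm _ hc; rwa [hcc] at this
  have h1 : #(AD ∪ coAD) = #AD + #AD := by rw [card_union_of_disjoint hdisj, hcoADcard]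
  have h2 : #(AD ∪ coAD) ≤ #(Cr \ Ch) := card_le_card hsub
  have h3 : #(genSharp g h) ≤ #AD := card_le_card hgenAD
  have h4 : #(Cr \ Ch) + #(Cr ∩ Ch) = #Cr := card_sdiff_add_card_inter Cr Ch
  have hDebeq : debtors g h = Ch \ Cr := by
    ext q; rw [hmemDeb, mem_sdiff, hmemCh, hmemCr]
  have h5 : #(Ch \ Cr) + #(Ch ∩ Cr) = #Ch := card_sdiff_add_card_inter Ch Cr
  have h6 : #(Ch ∩ Cr) = #(Cr ∩ Ch) := by rw [inter_comm]
  rw [← hDebeq] at h5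
  omega

/-- **Conjecture MS♯ implies Conjecture K♯** (`OrientedAntipodalHall.KSharp 3`, hence `ConjectureKSharp`, Conjecture K, FS′ and FS). -/
theorem kSharp_of_msSharp (hMS : MSSharp) : KSharp 3 := by
  intro α _ _ g h hg hh
  exact kSharp_ineq_of_msSharp_ineq g h hg hh (hMS α g h hg hh)

/-- The same, stated on the typed obligations. -/
theorem conjectureKSharp_of_conjectureMSSharp (hMS : ConjectureMSSharp) : ConjectureKSharp :=
  kSharp_of_msSharp hMS

end Reduction

end GeneratedDonors

end Summit.CriticalPhenomena.PercolationContinuityZ3.Theorems
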